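import Literature.Computability.Complexity.OccurrenceObstructionsIPHookPositivity
import HarnessLib

/-!
# Ikenmeyer–Panova 2017, Prop. 4.3 (the extension proposition) PROVED for every `ρ`

Sibling proofs file (D-0014) of `Literature/Computability/Complexity/OccurrenceObstructionsIP.lean`
(conventions as there and in `OccurrenceObstructionsIPHookPositivity.lean`: `a × b` =
`Nat.Partition.rectangle a b` = `a` rows of length `b`; everything over `ℂ`). Theorems only; no
definition, no statement of the tree is changed and no named fact is introduced.

Source: C. Ikenmeyer, G. Panova, *Rectangular Kronecker coefficients and plethysms in geometric
complexity theory*, Adv. Math. 319 (2017) 40–66 = arXiv:1512.03798 (held), §4, Prop. 4.3 (held: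
Prop. 20, p. 10): "Let `ρ` be a partition of length `ℓ` or `ρ = ∅` with `ℓ = 0`, and denote by
`ν^k := k × 1 + ρ` for `k ≥ ℓ` and let `R_ρ := |ρ| + ρ₁ + 1`. Suppose that there exists an integer
`a > max(√(R_ρ+ℓ) + 3, ℓ/2 - 1, 6)` and subsets `H¹_ρ, H²_ρ ⊆ [max(ℓ,1), 2a+1]` such that
`g(ν^k(a²), a × a, a × a) > 0` for all `k ∈ [ℓ, a² - R_ρ] ∖ (H¹_ρ ∪ (a² - H²_ρ))`. Then for every
`b ≥ a` we have that `g(ν^k(b²), b × b, b × b) > 0` for all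
`k ∈ [ℓ, b² - R_ρ] ∖ (H¹_ρ ∪ (b² - H²_ρ))`." (`ν(N)` = `ν` with a new first row of `N - |ν|`
boxes.) The companion file `OccurrenceObstructionsIPHookPositivity.lean` proves the instance
`ρ = ∅` (hooks, `hookSquare_pos`) with its base case derived; here the proposition is proved for
every `ρ`, as printed, from the semigroup and transposition properties (tree theorems).

## What is proved

* `getD_colAdd` — the rows of `ν^k = k × 1 + ρ`, rendered as the tree's row-wise sum
  `(1^k) + ρ = ((indiscrete k).transpose).rowAdd ρ` (row `r`: `[r < k] + ρ_r`), `exists_famShape`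
  (the shape `ν^k(N)` exists once `N ≥ k + R_ρ`), and **the conjugate of `ν^k(c²)`**
  (`famShape_transpose`): for `ℓ(ρ) ≤ k ≤ c² - R_ρ`, `(ν^k(c²))ᵀ = (k' × 1 + ρᵀ)(c²)` with
  `k' = c² - k - |ρ| - 1` — the first row minus a box becomes the first column and `ρ` is
  conjugated (column lengths counted with `lt_colLen_iff`; this is where `R_ρ` enters: `k' ≥ ρ₁ =
  ℓ(ρᵀ)`).
* The two moves of the printed proof for every `ρ`: `famSquare_pos_grow` (`k ∈ P_c ⇒ k ∈ P_{c'}`,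
  indeed positivity in every frame `a × b`, `a, b ≥ c`) and `famSquare_pos_grow_add`
  (`k ∈ P_c ⇒ k + 2c + 1 ∈ P_{c+1}`: transpose, grow, transpose back; `famSquare_pos_transpose`).
* `ikenmeyerPanova2017_prop_4_3_core`: the induction of the printed proof under the two sharp
  bookkeeping inequalities it actually uses — (I) `R + 2a + max(ℓ, M₁+1) < a² + 1` and
  (II) `M₂ + 2a + max(ℓ, M₁+1) < a²` when `H² ≠ ∅` (`Mᵢ` bounding `Hⁱ`) — which, unlike the printed
  `a > 6`, already hold at `a = 5` for the five `ρ ∈ 𝔛 ∖ {(3,1)}` of Cor. 4.5;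
* `ikenmeyerPanova2017_prop_4_3`: **Prop. 4.3 as printed** (the printed hypotheses imply (I), (II)).

## References

* C. Ikenmeyer, G. Panova, Adv. Math. 319 (2017) 40–66 = arXiv:1512.03798, §4, Prop. 4.3 and its
  proof (held text: Prop. 20, p. 10). [key `IkenmeyerPanova2017`]

## Mathlib and tree

Mathlib: `Nat.Partition`, `YoungDiagram.colLen`, `Finset.sum_range_succ'`, `Finset.sum_ite_of_true`,
`Nat.le_induction`. Tree: `partitionOfRows`, `getD_sortedParts_partitionOfRows`,
`antitone_getD_sortedParts`, `getD_sortedParts_eq_zero`, `sum_range_getD_sortedParts_of_le`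
(`OccurrenceObstructionsBIP/IP`); `Nat.Partition.transpose`, `Nat.Partition.transpose_transpose`,
`getD_sortedParts_transpose` (`Literature.NumberTheory.DiophantineGeometry`); `lt_colLen_iff`,
`colLen_eq_of_forall`, `kroneckerCoeff_pos_of_frame_le`, `kroneckerCoeff_square_frame_transpose`
(`OccurrenceObstructionsIPHookPositivity`).
-/

noncomputable section

open scoped BigOperators

namespace Literature.Computability.Complexity

open Literature.NumberTheory.DiophantineGeometry (kroneckerCoeff kroneckerCoeff_transpose₁₂
  getD_sortedParts_transpose getD_sortedParts_indiscrete_transpose rowLen_youngDiagram)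

/-! ### The shapes `ν^k = k × 1 + ρ` through their rows -/

section FamRows

variable {m : ℕ}

/-- **The rows of IP's `ν^k := k × 1 + ρ`** (a column of `k` boxes with `ρ` attached to its
right, as the row-wise sum `(1^k) + ρ` of the tree; Prop. 4.3, held: Prop. 20): row `r` (from `0`)
is `[r < k] + ρ_r`. These are the rows BELOW the first row of `ν^k(N)` ("`ν` with a new first row").
[cite: IkenmeyerPanova2017, Prop. 4.3 (notation ν^k := k × 1 + ρ; held: Prop. 20, p. 10)] -/
theorem getD_colAdd (ρ : Nat.Partition m) (k r : ℕ) :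
    ((Nat.Partition.indiscrete k).transpose.rowAdd ρ).sortedParts.getD r 0 =
      (if r < k then 1 else 0) + ρ.sortedParts.getD r 0 := by
  rw [getD_sortedParts_rowAdd, getD_sortedParts_indiscrete_transpose]

/-- The rows of `ν^k` are weakly decreasing. [folklore] -/
theorem colAdd_rows_antitone (ρ : Nat.Partition m) (k : ℕ) :
    Antitone fun r => ((Nat.Partition.indiscrete k).transpose.rowAdd ρ).sortedParts.getD r 0 :=
  antitone_getD_sortedParts _

/-- A zero-padded part is positive exactly below the number of parts. [folklore] -/
theorem getD_sortedParts_pos_iff {N : ℕ} (μ : Nat.Partition N) (i : ℕ) :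
    0 < μ.sortedParts.getD i 0 ↔ i < μ.parts.card := by
  rw [← Nat.Partition.length_sortedParts]
  constructor
  · intro h
    by_contra hi
    rw [List.getD_eq_default _ _ (not_lt.1 hi)] at h
    exact lt_irrefl 0 h
  · intro hi
    rw [List.getD_eq_getElem _ _ hi]
    exact μ.parts_pos ((Multiset.mem_sort _).1 (List.getElem_mem hi))

/-- Beyond row `k ≥ ℓ(ρ)` the shape `ν^k` has no boxes. [folklore] -/
theorem getD_colAdd_eq_zero (ρ : Nat.Partition m) {k r : ℕ} (hk : ρ.parts.card ≤ k) (hr : k ≤ r) :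
    ((Nat.Partition.indiscrete k).transpose.rowAdd ρ).sortedParts.getD r 0 = 0 := by
  rw [getD_colAdd, if_neg (by omega), getD_sortedParts_eq_zero ρ (hk.trans hr)]

/-- The rows of `ν^k` (`k ≥ ℓ(ρ)`) sum to `k + |ρ|`. [folklore] -/
theorem sum_getD_colAdd (ρ : Nat.Partition m) {k : ℕ} (hk : ρ.parts.card ≤ k) :
    ∑ r ∈ Finset.range k, ((Nat.Partition.indiscrete k).transpose.rowAdd ρ).sortedParts.getD r 0 =
      k + m := by
  simp only [getD_colAdd, Finset.sum_add_distrib]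
  rw [Finset.sum_ite_of_true (fun r hr => Finset.mem_range.1 hr), Finset.sum_const,
    Finset.card_range, smul_eq_mul, mul_one, sum_range_getD_sortedParts_of_le ρ hk]

/-- **The shape `ν^k(N)` exists**: for `k ≥ ℓ(ρ)` and `N ≥ k + |ρ| + ρ₁ + 1` (room for a first
row at least as long as the second) there is a partition of `N` whose rows below the first are the
rows of `ν^k = k × 1 + ρ`. [cite: IkenmeyerPanova2017, Prop. 4.3 (ν^k(b²); held: Prop. 20, p. 10)] -/
theorem exists_famShape (ρ : Nat.Partition m) {k N : ℕ} (hk : ρ.parts.card ≤ k)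
    (hN : k + m + ρ.sortedParts.getD 0 0 + 1 ≤ N) :
    ∃ lam : Nat.Partition N, ∀ r, lam.sortedParts.getD (r + 1) 0 =
      ((Nat.Partition.indiscrete k).transpose.rowAdd ρ).sortedParts.getD r 0 := by
  set w : ℕ → ℕ := fun r => if r = 0 then N - (k + m) else
    ((Nat.Partition.indiscrete k).transpose.rowAdd ρ).sortedParts.getD (r - 1) 0 with hw
  have hanti : Antitone w := by
    intro i j hij
    simp only [hw]
    by_cases hj : j = 0
    · subst hj
      have hi : i = 0 := by omega
      subst hi; exact le_rfl
    rw [if_neg hj]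
    by_cases hi : i = 0
    · rw [if_pos hi]
      refine ((colAdd_rows_antitone ρ k) (Nat.zero_le (j - 1))).trans ?_
      dsimp only
      rw [getD_colAdd]
      split_ifs <;> omega
    · rw [if_neg hi]
      exact colAdd_rows_antitone ρ k (by omega)
  have hsum : ∑ r ∈ Finset.range (k + 1), w r = N := by
    rw [Finset.sum_range_succ']
    simp only [hw, Nat.succ_ne_zero, if_false, Nat.add_sub_cancel, if_true]
    rw [sum_getD_colAdd ρ hk]
    omega
  refine ⟨partitionOfRows w (k + 1) N, fun r => ?_⟩
  rw [getD_sortedParts_partitionOfRows hanti hsum]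
  simp only [hw, Nat.succ_ne_zero, if_false, Nat.add_sub_cancel]
  split_ifs with h
  · rfl
  · exact (getD_colAdd_eq_zero ρ hk (by omega)).symm

/-- The first row of a partition is its size minus the rows below the first. [folklore] -/
theorem getD_zero_eq_sub_of_rows {N : ℕ} (lam : Nat.Partition N) {f : ℕ → ℕ} {L S : ℕ}
    (hrows : ∀ r, lam.sortedParts.getD (r + 1) 0 = f r) (hf : ∀ r, L ≤ r → f r = 0)
    (hS : ∑ r ∈ Finset.range L, f r = S) : lam.sortedParts.getD 0 0 = N - S ∧ S ≤ N := by
  have hcard : lam.parts.card ≤ L + 1 := by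
    by_contra h
    have hpos := (getD_sortedParts_pos_iff lam (L + 1)).2 (by omega)
    rw [hrows L, hf L le_rfl] at hpos
    exact lt_irrefl 0 hpos
  have h := sum_range_getD_sortedParts_of_le lam hcard
  rw [Finset.sum_range_succ'] at h
  simp only [hrows] at h
  rw [hS] at h
  omega

/-- The first row of `ν^k(N)` is `N - k - |ρ|`. [folklore] -/
theorem getD_zero_of_famShape (ρ : Nat.Partition m) {k N : ℕ} (hk : ρ.parts.card ≤ k)
    (lam : Nat.Partition N) (hlam : ∀ r, lam.sortedParts.getD (r + 1) 0 =
      ((Nat.Partition.indiscrete k).transpose.rowAdd ρ).sortedParts.getD r 0) :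
    lam.sortedParts.getD 0 0 = N - (k + m) ∧ k + m ≤ N :=
  getD_zero_eq_sub_of_rows lam hlam (fun _ hr => getD_colAdd_eq_zero ρ hk hr) (sum_getD_colAdd ρ hk)

/-- The transpose has `ρ₁` parts: `ℓ(ρᵀ) = ρ₁`. [folklore] -/
theorem card_parts_transpose_eq {N : ℕ} (ρ : Nat.Partition N) :
    ρ.transpose.parts.card = ρ.sortedParts.getD 0 0 := by
  have key : ∀ i, i < ρ.transpose.parts.card ↔ i < ρ.sortedParts.getD 0 0 := fun i => by
    rw [← getD_sortedParts_pos_iff, getD_sortedParts_transpose, ← lt_colLen_iff]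
  refine le_antisymm (not_lt.1 fun h => ?_) (not_lt.1 fun h => ?_)
  · exact lt_irrefl _ ((key _).1 h)
  · exact lt_irrefl _ ((key _).2 h)

/-- The rows of the transpose: `ρᵀ_i = #{j : ρ_j > i}`, i.e. `j < ρᵀ_i ↔ i < ρ_j`. [folklore] -/
theorem lt_getD_transpose_iff {N : ℕ} (ρ : Nat.Partition N) (i j : ℕ) :
    j < ρ.transpose.sortedParts.getD i 0 ↔ i < ρ.sortedParts.getD j 0 := by
  rw [getD_sortedParts_transpose, lt_colLen_iff]

/-- **Transposing `ν^k(c²)`** (IP, proof of Prop. 4.3: "we first transpose `ν^k(c²)` …"): for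
`k ≥ ℓ(ρ)` and `k ≤ c² - R_ρ`, `R_ρ = |ρ| + ρ₁ + 1`, the conjugate of `ν^k(c²) = (k × 1 + ρ)(c²)` is
`(k' × 1 + ρᵀ)(c²)` with `k' = c² - k - |ρ| - 1` (the old first row, minus its first box, becomes the
new first column; `ρ` is conjugated). [cite: IkenmeyerPanova2017, Prop. 4.3 (proof of the claim; held: Prop. 20, p. 10)] -/
theorem famShape_transpose (ρ : Nat.Partition m) {k M : ℕ} (hk : ρ.parts.card ≤ k)
    (hR : k + m + ρ.sortedParts.getD 0 0 + 1 ≤ M) (lam : Nat.Partition M)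
    (hlam : ∀ r, lam.sortedParts.getD (r + 1) 0 =
      ((Nat.Partition.indiscrete k).transpose.rowAdd ρ).sortedParts.getD r 0) :
    ∀ r, lam.transpose.sortedParts.getD (r + 1) 0 =
      ((Nat.Partition.indiscrete (M - (k + m) - 1)).transpose.rowAdd ρ.transpose).sortedParts.getD r 0 := by
  intro r
  obtain ⟨h0, -⟩ := getD_zero_of_famShape ρ hk lam hlam
  rw [getD_sortedParts_transpose]
  refine colLen_eq_of_forall lam fun i => ?_
  rw [getD_colAdd]
  cases i with
  | zero =>
    rw [h0]
    constructor
    · intro h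
      rw [if_pos (by omega)]; omega
    · intro h
      by_cases hr : r < M - (k + m) - 1
      · omega
      · rw [if_neg hr, zero_add] at h
        -- `ρᵀ_r > 0` forces `r < ρ₁ ≤ k'`
        have h' := (lt_getD_transpose_iff ρ r 0).1 h
        omega
  | succ i =>
    rw [hlam i, getD_colAdd]
    have hanti := antitone_getD_sortedParts ρ (Nat.zero_le i)
    dsimp only at hanti
    constructor
    · intro h
      -- `r + 1 < [i<k] + ρ_i` forces `r < ρ_i`, whence `i < ρᵀ_r` and `r < ρ₁ ≤ k'`
      have hri : r < ρ.sortedParts.getD i 0 := by split_ifs at h <;> omega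
      have h2 : i < ρ.transpose.sortedParts.getD r 0 := (lt_getD_transpose_iff ρ r i).2 hri
      rw [if_pos (by omega)]
      omega
    · intro h
      by_cases hr : r < M - (k + m) - 1
      · rw [if_pos hr] at h
        have h2 : i < ρ.transpose.sortedParts.getD r 0 := by omega
        have hri := (lt_getD_transpose_iff ρ r i).1 h2
        have hik : i < k := by
          have : 0 < ρ.sortedParts.getD i 0 := by omega
          exact lt_of_lt_of_le ((getD_sortedParts_pos_iff ρ i).1 this) hk
        rw [if_pos hik]
        omega
      · rw [if_neg hr, zero_add] at h
        have h2 : 0 < ρ.transpose.sortedParts.getD r 0 := by omega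
        have hri := (lt_getD_transpose_iff ρ r 0).1 h2
        omega

end FamRows

/-! ### The two moves of the proof of Prop. 4.3 for a general `ρ` -/

section FamMoves

variable {m : ℕ}

/-- **Growing the frame**: if `g(ν^k(c²), c × c, c × c) > 0` then `g(ν^k(ab), a × b, a × b) > 0`
for all `a, b ≥ c` (add one-row triples; IP, proof of Prop. 4.3, first half of the claim:
"`k ∈ P_c` implies `k ∈ P_{c+1}`"). The shapes are described by their rows below the first.
[cite: IkenmeyerPanova2017, Prop. 4.3 (proof of the claim; held: Prop. 20, p. 10)] -/
theorem famSquare_pos_grow (ρ : Nat.Partition m) {k c : ℕ} (hk : ρ.parts.card ≤ k)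
    (hR : k + m + ρ.sortedParts.getD 0 0 + 1 ≤ c * c)
    (h : ∀ lam : Nat.Partition (c * c), (∀ r, lam.sortedParts.getD (r + 1) 0 =
      ((Nat.Partition.indiscrete k).transpose.rowAdd ρ).sortedParts.getD r 0) →
      0 < kroneckerCoeff ℂ lam (Nat.Partition.rectangle c c) (Nat.Partition.rectangle c c))
    {a b : ℕ} (hca : c ≤ a) (hcb : c ≤ b) (lam : Nat.Partition (a * b))
    (hlam : ∀ r, lam.sortedParts.getD (r + 1) 0 =
      ((Nat.Partition.indiscrete k).transpose.rowAdd ρ).sortedParts.getD r 0) :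
    0 < kroneckerCoeff ℂ lam (Nat.Partition.rectangle a b) (Nat.Partition.rectangle a b) := by
  obtain ⟨mu, hmu⟩ := exists_famShape ρ hk hR
  exact kroneckerCoeff_pos_of_frame_le mu (h mu hmu) hca hcb lam fun r => by rw [hlam r, hmu r]

/-- **Transposing against the square**: if `g(ν^k(c²), c × c, c × c) > 0` (`ν^k = k × 1 + ρ`,
`ℓ(ρ) ≤ k ≤ c² - R_ρ`) then `g(ν^{k'}(c²), c × c, c × c) > 0` for `ν^{k'} = k' × 1 + ρᵀ`,
`k' = c² - k - |ρ| - 1` (IP, proof of Prop. 4.3: transpose the shape and one of the squares,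
`famShape_transpose`, `kroneckerCoeff_square_frame_transpose`).
[cite: IkenmeyerPanova2017, Prop. 4.3 (proof of the claim; held: Prop. 20, p. 10)] -/
theorem famSquare_pos_transpose (ρ : Nat.Partition m) {k c : ℕ} (hk : ρ.parts.card ≤ k)
    (hR : k + m + ρ.sortedParts.getD 0 0 + 1 ≤ c * c)
    (h : ∀ lam : Nat.Partition (c * c), (∀ r, lam.sortedParts.getD (r + 1) 0 =
      ((Nat.Partition.indiscrete k).transpose.rowAdd ρ).sortedParts.getD r 0) →
      0 < kroneckerCoeff ℂ lam (Nat.Partition.rectangle c c) (Nat.Partition.rectangle c c))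
    (lam : Nat.Partition (c * c))
    (hlam : ∀ r, lam.sortedParts.getD (r + 1) 0 =
      ((Nat.Partition.indiscrete (c * c - (k + m) - 1)).transpose.rowAdd ρ.transpose).sortedParts.getD r 0) :
    0 < kroneckerCoeff ℂ lam (Nat.Partition.rectangle c c) (Nat.Partition.rectangle c c) := by
  have hcardT := card_parts_transpose_eq ρ
  have hcardTT := card_parts_transpose_eq ρ.transpose
  rw [Nat.Partition.transpose_transpose] at hcardTT
  have hk' : ρ.transpose.parts.card ≤ c * c - (k + m) - 1 := by omega
  have hR' : c * c - (k + m) - 1 + m + ρ.transpose.sortedParts.getD 0 0 + 1 ≤ c * c := by omega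
  have ht := famShape_transpose ρ.transpose hk' hR' lam hlam
  rw [Nat.Partition.transpose_transpose] at ht
  have e : c * c - (c * c - (k + m) - 1 + m) - 1 = k := by omega
  have hpos := h lam.transpose fun r => by rw [ht r, e]
  rwa [← kroneckerCoeff_square_frame_transpose] at hpos

/-- **The claim in the proof of IP Prop. 4.3, for every `ρ`**: "`k ∈ P_c` implies
`k + 2c + 1 ∈ P_{c+1}`", where `P_c = {k : g(ν^k(c²), c × c, c × c) > 0}`, `ν^k = k × 1 + ρ`,
`ℓ(ρ) ≤ k ≤ c² - R_ρ` — transpose (`ρ ↦ ρᵀ`, `k ↦ c² - k - |ρ| - 1`), grow the square, transpose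
back. [cite: IkenmeyerPanova2017, Prop. 4.3 (proof of the claim; held: Prop. 20, p. 10)] -/
theorem famSquare_pos_grow_add (ρ : Nat.Partition m) {k c : ℕ} (hk : ρ.parts.card ≤ k)
    (hR : k + m + ρ.sortedParts.getD 0 0 + 1 ≤ c * c)
    (h : ∀ lam : Nat.Partition (c * c), (∀ r, lam.sortedParts.getD (r + 1) 0 =
      ((Nat.Partition.indiscrete k).transpose.rowAdd ρ).sortedParts.getD r 0) →
      0 < kroneckerCoeff ℂ lam (Nat.Partition.rectangle c c) (Nat.Partition.rectangle c c))
    (lam : Nat.Partition ((c + 1) * (c + 1)))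
    (hlam : ∀ r, lam.sortedParts.getD (r + 1) 0 =
      ((Nat.Partition.indiscrete (k + 2 * c + 1)).transpose.rowAdd ρ).sortedParts.getD r 0) :
    0 < kroneckerCoeff ℂ lam (Nat.Partition.rectangle (c + 1) (c + 1))
      (Nat.Partition.rectangle (c + 1) (c + 1)) := by
  have hcardT := card_parts_transpose_eq ρ
  have hcardTT := card_parts_transpose_eq ρ.transpose
  rw [Nat.Partition.transpose_transpose] at hcardTT
  -- transpose at `c`
  have h₁ := famSquare_pos_transpose ρ hk hR h
  have hk' : ρ.transpose.parts.card ≤ c * c - (k + m) - 1 := by omega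
  have hR' : c * c - (k + m) - 1 + m + ρ.transpose.sortedParts.getD 0 0 + 1 ≤ c * c := by omega
  -- grow to `c + 1`
  have hR'' : c * c - (k + m) - 1 + m + ρ.transpose.sortedParts.getD 0 0 + 1 ≤ (c + 1) * (c + 1) :=
    hR'.trans (Nat.mul_le_mul (Nat.le_succ c) (Nat.le_succ c))
  have h₂ : ∀ mu : Nat.Partition ((c + 1) * (c + 1)),
      (∀ r, mu.sortedParts.getD (r + 1) 0 = ((Nat.Partition.indiscrete (c * c - (k + m) - 1)).transpose.rowAdd ρ.transpose).sortedParts.getD r 0) →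
      0 < kroneckerCoeff ℂ mu (Nat.Partition.rectangle (c + 1) (c + 1))
        (Nat.Partition.rectangle (c + 1) (c + 1)) :=
    fun mu hmu => famSquare_pos_grow ρ.transpose hk' hR' h₁ (Nat.le_succ c) (Nat.le_succ c) mu hmu
  -- transpose back at `c + 1`
  have h₃ := famSquare_pos_transpose ρ.transpose hk' hR'' h₂
  rw [Nat.Partition.transpose_transpose] at h₃
  have e : (c + 1) * (c + 1) - (c * c - (k + m) - 1 + m) - 1 = k + 2 * c + 1 := by
    have : (c + 1) * (c + 1) = c * c + 2 * c + 1 := by ring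
    omega
  exact h₃ lam fun r => by rw [hlam r, e]

end FamMoves

/-! ### IP Prop. 4.3 (held: Prop. 20) for every `ρ` -/

section Prop43

variable {m : ℕ}

/-- **IP Prop. 4.3 with the sharp bookkeeping conditions.** Let `ρ ⊢ m`, `ℓ = ℓ(ρ)`,
`R = R_ρ = m + ρ₁ + 1`, `H₁, H₂` finite sets of naturals bounded by `M₁, M₂`, and `a ≥ 1` with
(I) `R + 2a + max(ℓ, M₁ + 1) < a² + 1` and (II) `M₂ + 2a + max(ℓ, M₁ + 1) < a²` if `H₂ ≠ ∅`. If
`g(ν^k(a²), a × a, a × a) > 0` for all `k ∈ [ℓ, a² - R] ∖ (H₁ ∪ (a² - H₂))`, then for every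
`b ≥ a`, `g(ν^k(b²), b × b, b × b) > 0` for all `k ∈ [ℓ, b² - R] ∖ (H₁ ∪ (b² - H₂))`. This is
the induction of the printed proof (claim: `P_c ∪ (2c + 1 + P_c) ⊆ P_{c+1}`; a `k` in the new
range not covered would have `k` and `k - (2c+1)` both outside the old range, which (I) and (II)
forbid); the printed hypotheses `a > max(√(R+ℓ) + 3, ℓ/2 - 1, 6)`, `Hⁱ ⊆ [max(ℓ,1), 2a + 1]`
imply (I) and (II) (`ikenmeyerPanova2017_prop_4_3`), while (I), (II) also hold in smaller frames
(e.g. `a = 5` for the five `ρ ∈ 𝔛 ∖ {(3,1)}` of Cor. 4.5). Shapes are described by their rows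
below the first (those of `(1^k) + ρ`, `getD_colAdd`). [cite: IkenmeyerPanova2017, Prop. 4.3 (held: Prop. 20, p. 10)] -/
theorem ikenmeyerPanova2017_prop_4_3_core (ρ : Nat.Partition m) (H₁ H₂ : Finset ℕ)
    {M₁ M₂ a : ℕ} (hM₁ : ∀ x ∈ H₁, x ≤ M₁) (hM₂ : ∀ x ∈ H₂, x ≤ M₂) (ha : 1 ≤ a)
    (hI : m + ρ.sortedParts.getD 0 0 + 1 + 2 * a + max ρ.parts.card (M₁ + 1) < a * a + 1)
    (hII : H₂.Nonempty → M₂ + 2 * a + max ρ.parts.card (M₁ + 1) < a * a)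
    (hbase : ∀ k, ρ.parts.card ≤ k → k + m + ρ.sortedParts.getD 0 0 + 1 ≤ a * a → k ∉ H₁ →
      a * a - k ∉ H₂ → ∀ lam : Nat.Partition (a * a),
        (∀ r, lam.sortedParts.getD (r + 1) 0 = ((Nat.Partition.indiscrete k).transpose.rowAdd ρ).sortedParts.getD r 0) →
        0 < kroneckerCoeff ℂ lam (Nat.Partition.rectangle a a) (Nat.Partition.rectangle a a))
    {b : ℕ} (hab : a ≤ b) {k : ℕ} (hk : ρ.parts.card ≤ k)
    (hR : k + m + ρ.sortedParts.getD 0 0 + 1 ≤ b * b) (h₁ : k ∉ H₁) (h₂ : b * b - k ∉ H₂)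
    (lam : Nat.Partition (b * b)) (hlam : ∀ r, lam.sortedParts.getD (r + 1) 0 =
      ((Nat.Partition.indiscrete k).transpose.rowAdd ρ).sortedParts.getD r 0) :
    0 < kroneckerCoeff ℂ lam (Nat.Partition.rectangle b b) (Nat.Partition.rectangle b b) := by
  induction b, hab using Nat.le_induction generalizing k with
  | base => exact hbase k hk hR h₁ h₂ lam hlam
  | succ c hac ih =>
    -- the bookkeeping conditions at `c`
    have hmono : a * a + 2 * c ≤ c * c + 2 * a := by nlinarith
    have hcI : m + ρ.sortedParts.getD 0 0 + 1 + 2 * c + max ρ.parts.card (M₁ + 1) < c * c + 1 := by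
      omega
    have hcII : H₂.Nonempty → M₂ + 2 * c + max ρ.parts.card (M₁ + 1) < c * c := fun hne => by
      have := hII hne; omega
    have ec : (c + 1) * (c + 1) = c * c + 2 * c + 1 := by ring
    by_cases hA : k + m + ρ.sortedParts.getD 0 0 + 1 ≤ c * c ∧ c * c - k ∉ H₂
    · -- `k ∈ P_c`: grow
      exact famSquare_pos_grow ρ hk hA.1 (fun mu hmu => ih hk hA.1 h₁ hA.2 mu hmu) (Nat.le_succ c)
        (Nat.le_succ c) lam hlam
    · -- otherwise `k - (2c + 1) ∈ P_c`: grow and transpose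
      have hbig : 2 * c + max ρ.parts.card (M₁ + 1) < k := by
        rw [not_and_or, not_le, not_not] at hA
        rcases hA with hA | hA
        · omega
        · have hx := hM₂ _ hA
          have hlt := hcII ⟨_, hA⟩
          omega
      obtain ⟨k₀, rfl⟩ : ∃ k₀, k = k₀ + 2 * c + 1 := ⟨k - (2 * c + 1), by omega⟩
      have hk₀ : ρ.parts.card ≤ k₀ := by
        have := le_max_left ρ.parts.card (M₁ + 1); omega
      have hR₀ : k₀ + m + ρ.sortedParts.getD 0 0 + 1 ≤ c * c := by rw [ec] at hR; omega
      have h₁₀ : k₀ ∉ H₁ := fun hx => by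
        have := hM₁ _ hx
        have := le_max_right ρ.parts.card (M₁ + 1)
        omega
      have h₂₀ : c * c - k₀ ∉ H₂ := by
        have e : c * c - k₀ = (c + 1) * (c + 1) - (k₀ + 2 * c + 1) := by rw [ec]; omega
        rw [e]; exact h₂
      exact famSquare_pos_grow_add ρ hk₀ hR₀ (fun mu hmu => ih hk₀ hR₀ h₁₀ h₂₀ mu hmu) lam hlam

/-- **Ikenmeyer–Panova, Adv. Math. 319 (2017), Prop. 4.3 (held arXiv text: Prop. 20), PROVED.**
"Let `ρ` be a partition of length `ℓ` or `ρ = ∅` with `ℓ = 0`, and denote by `ν^k := k × 1 + ρ`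
for `k ≥ ℓ` and let `R_ρ := |ρ| + ρ₁ + 1`. Suppose that there exists an integer
`a > max(√(R_ρ + ℓ) + 3, ℓ/2 - 1, 6)` and subsets `H¹_ρ, H²_ρ ⊆ [max(ℓ,1), 2a+1]` such that
`g(ν^k(a²), a × a, a × a) > 0` for all `k ∈ [ℓ, a² - R_ρ] ∖ (H¹_ρ ∪ (a² - H²_ρ))`. Then for every
`b ≥ a` we have that `g(ν^k(b²), b × b, b × b) > 0` for all
`k ∈ [ℓ, b² - R_ρ] ∖ (H¹_ρ ∪ (b² - H²_ρ))`." Rendering: `ν^k(N)` = any partition of `N` whose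
rows below the first are those of the row-wise sum `(1^k) + ρ` (row `r`: `[r < k] + ρ_r`, `getD_colAdd`); `k ∈ b² - H²` is `b² - k ∈ H²`;
`a > √(R+ℓ) + 3` is `R + ℓ < (a-3)²`, `a > ℓ/2 - 1` is `ℓ < 2a + 2`, `a > 6` is `7 ≤ a`; of the
printed `Hⁱ ⊆ [max(ℓ,1), 2a+1]` only the upper bound is used (and assumed). Proof as printed
(`ikenmeyerPanova2017_prop_4_3_core`), the semigroup and transposition properties being tree
theorems. [cite: IkenmeyerPanova2017, Prop. 4.3 (held: Prop. 20, p. 10)] -/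
theorem ikenmeyerPanova2017_prop_4_3 (ρ : Nat.Partition m) (H₁ H₂ : Finset ℕ) {a : ℕ}
    (ha7 : 7 ≤ a) (haR : m + ρ.sortedParts.getD 0 0 + 1 + ρ.parts.card < (a - 3) * (a - 3))
    (haℓ : ρ.parts.card < 2 * a + 2) (hH₁ : ∀ x ∈ H₁, x ≤ 2 * a + 1) (hH₂ : ∀ x ∈ H₂, x ≤ 2 * a + 1)
    (hbase : ∀ k, ρ.parts.card ≤ k → k + m + ρ.sortedParts.getD 0 0 + 1 ≤ a * a → k ∉ H₁ →
      a * a - k ∉ H₂ → ∀ lam : Nat.Partition (a * a),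
        (∀ r, lam.sortedParts.getD (r + 1) 0 = ((Nat.Partition.indiscrete k).transpose.rowAdd ρ).sortedParts.getD r 0) →
        0 < kroneckerCoeff ℂ lam (Nat.Partition.rectangle a a) (Nat.Partition.rectangle a a))
    {b : ℕ} (hab : a ≤ b) {k : ℕ} (hk : ρ.parts.card ≤ k)
    (hR : k + m + ρ.sortedParts.getD 0 0 + 1 ≤ b * b) (h₁ : k ∉ H₁) (h₂ : b * b - k ∉ H₂)
    (lam : Nat.Partition (b * b)) (hlam : ∀ r, lam.sortedParts.getD (r + 1) 0 =
      ((Nat.Partition.indiscrete k).transpose.rowAdd ρ).sortedParts.getD r 0) :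
    0 < kroneckerCoeff ℂ lam (Nat.Partition.rectangle b b) (Nat.Partition.rectangle b b) := by
  obtain ⟨a', rfl⟩ : ∃ a', a = a' + 3 := ⟨a - 3, by omega⟩
  rw [Nat.add_sub_cancel] at haR
  refine ikenmeyerPanova2017_prop_4_3_core ρ H₁ H₂ hH₁ hH₂ (by omega) ?_ ?_ hbase hab hk hR h₁ h₂
    lam hlam
  · rw [max_eq_right (by omega)]
    nlinarith
  · intro _
    rw [max_eq_right (by omega)]
    nlinarith

end Prop43

end Literature.Computability.Complexity
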